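import Literature.Analysis.FluidPDE.CompressibleEulerImplosionCentreSeriesTM
import HarnessLib

/-!
# Buckmaster–Cao-Labora–Gómez-Serrano at `γ = 5/3`: the Taylor models of the eight bulk envelopes of the pinned profile

Companion of `…CentreSeriesTM` (Taylor models `tmW`, `tmU` in `ζ = c eˣ` of `W, W′, W″` and `c·eˣS, c·(eˣS)′, c·(eˣS)″`
of the series profile on the shooting window). The crux `DenseExcursion` (line `sonic-cavity-renewal`, clause (g)
`CavityTubeBulk` of the cavity tube) consumes pointwise envelopes, on the bulk `log(1/100) ≤ x ≤ −7/10` of the core, of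
eight rational functions of `(W, W′, W″, S, S′, S″)(x)`: the couplings `G, G′, H, H′, |b₋₊||b₊₋|/(2S)`, the drift `R′`,
the growth `b₊₊/c₊ + b₋₋/|c₋|` and the slowness `1/c₊ + 1/|c₋|`. Multiplying through by the positive quantities `ζS`,
`ζc₊`, `−ζc₋`, `ζ`, every envelope becomes the SIGN of a polynomial in the nine reals
`(W, W′, W″, U₀, U₁, U₂, ζ, r, c)`, `U_m = c·(eˣS)^{(m)}` (`ζS = U₀`, `ζS′ = U₁ − U₀`, `ζS″ = U₂ − 2U₁ + U₀`) — the
seventeen conditions `Pt.Pos` below. This file builds the corresponding KERNEL-COMPUTABLE Taylor models (`F_…`), proves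
that they enclose the seventeen polynomial functions of `ζ` (`tmem_…`), and packages the kernel check of one
`(c, ζ)`-piece as the boolean `bulkChk`, with its soundness theorem `pos_of_bulkChk`. No facts, no axioms.

[cite: BuckmasterCaolaboraGomezserrano2025, Prop. 2.5, App. B]
-/

noncomputable section

namespace Literature.Analysis.FluidPDE

namespace BuckmasterCaolaboraGomezserrano2025

namespace OriginSeries

namespace CentreW2

open Literature.Analysis.ValidatedNumerics Literature.Analysis.ValidatedNumerics.PolyMP
open Literature.Analysis.ValidatedNumerics.NumericsMP

set_option linter.style.longLine false
set_option linter.style.setOption false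
set_option maxRecDepth 100000
set_option maxHeartbeats 4000000

/-! ### The nine reals at a point and the seventeen polynomial conditions -/

/-- The nine reals `(W, W′, W″, U₀, U₁, U₂, ζ, r, c)` at a point of the bulk. [folklore] -/
structure Pt where
  /-- `W` -/
  W0 : ℝ
  /-- `W′` -/
  W1 : ℝ
  /-- `W″` -/
  W2 : ℝ
  /-- `U₀ = c·eˣS = ζS` -/
  U0 : ℝ
  /-- `U₁ = c·(eˣS)′` -/
  U1 : ℝ
  /-- `U₂ = c·(eˣS)″` -/
  U2 : ℝ
  /-- `ζ = c eˣ` -/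
  z : ℝ
  /-- the speed `r` -/
  r : ℝ
  /-- the sonic scale `c` -/
  c : ℝ

namespace Pt

variable (p : Pt)

/-- `ζS`. [folklore] -/
def s0 : ℝ := p.U0
/-- `ζS′`. [folklore] -/
def s1 : ℝ := p.U1 - p.U0
/-- `ζS″`. [folklore] -/
def s2 : ℝ := p.U2 - 2 * p.U1 + p.U0
/-- `ζ b₋₊ = ζ(W′/3 − S′ − 2S)`. [folklore] -/
def A : ℝ := p.z * p.W1 / 3 - p.s1 - 2 * p.s0
/-- `ζ b₊₋ = ζ(W′/3 + S′ + 2S)`. [folklore] -/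
def Ap : ℝ := p.z * p.W1 / 3 + p.s1 + 2 * p.s0
/-- `ζ c₊ = ζ(W − 1 + S)`. [folklore] -/
def B : ℝ := p.z * (p.W0 - 1) + p.s0
/-- `ζ c₋ = ζ(W − 1 − S)`. [folklore] -/
def Bm : ℝ := p.z * (p.W0 - 1) - p.s0
/-- `ζ (b₋₊)′`. [folklore] -/
def Ad : ℝ := p.z * p.W2 / 3 - p.s2 - 2 * p.s1
/-- `ζ (b₊₋)′`. [folklore] -/
def Apd : ℝ := p.z * p.W2 / 3 + p.s2 + 2 * p.s1
/-- `ζ (c₊)′`. [folklore] -/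
def Bd : ℝ := p.z * p.W1 + p.s1
/-- `ζ (c₋)′`. [folklore] -/
def Bmd : ℝ := p.z * p.W1 - p.s1
/-- `⅔W′ + 2W − r`. [folklore] -/
def K : ℝ := 2 * p.W1 / 3 + 2 * p.W0 - p.r
/-- `2ζS′ + 4ζS`. [folklore] -/
def P24 : ℝ := 2 * p.s1 + 4 * p.s0
/-- Numerator of `G′`: `G′ = numG/(2 (ζS)² ζ)`. [folklore] -/
def numG : ℝ := (p.Ad * p.B + p.A * p.Bd) * p.s0 - p.A * p.B * p.s1
/-- Numerator of `H′`. [folklore] -/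
def numH : ℝ := (p.Apd * p.Bm + p.Ap * p.Bmd) * p.s0 - p.Ap * p.Bm * p.s1
/-- Numerator of `R′`: `R′ = numR/(ζS)²`. [folklore] -/
def numR : ℝ := p.W1 * p.P24 * p.s0 - (2 * p.W2 / 3 + 2 * p.W1) * (p.s0 * p.s0) + (p.W0 - 1) * (2 * (p.s2 * p.s0) - 2 * (p.s1 * p.s1))
/-- `e(3 + 4e²ζ² + 10e⁴ζ⁴)` (`e = 1/c`: the growth bound divided by `ζ`). [folklore] -/
def rhs7 (e : ℝ) : ℝ := e * (3 * 1 + 4 * (e * e * (p.z * p.z)) + 10 * (e * e * (p.z * p.z) * (e * e * (p.z * p.z))))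
/-- `e(17/5 + 4e²ζ² + 8e⁴ζ⁴)` (the slowness bound divided by `ζ`). [folklore] -/
def rhs8 (e : ℝ) : ℝ := e * (17 * 1 / 5 + 4 * (e * e * (p.z * p.z)) + 8 * (e * e * (p.z * p.z) * (e * e * (p.z * p.z))))

/-- THE SEVENTEEN SIGN CONDITIONS: positivity of `ζS`, `ζc₊`, `−ζc₋`, and the two-sided polynomial forms of the eight
bulk envelopes (B7, B8 one-sided, with the bound evaluated at `e ≤ 1/c`). [folklore] -/
def Pos (e : ℝ) : Prop :=
  0 < p.s0 ∧ 0 < p.B ∧ 0 < -p.Bm ∧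
  0 < p.c * p.s0 - p.A * p.B ∧ 0 < p.c * p.s0 + p.A * p.B ∧
  0 < 51 * (p.c * (p.s0 * p.s0)) / 50 - p.numG ∧ 0 < 51 * (p.c * (p.s0 * p.s0)) / 50 + p.numG ∧
  0 < p.s0 * (51 * p.c / 50 + 61 * p.z / 50) - p.Ap * p.Bm ∧ 0 < p.s0 * (51 * p.c / 50 + 61 * p.z / 50) + p.Ap * p.Bm ∧
  0 < 51 * (p.c * (p.s0 * p.s0)) / 50 - p.numH ∧ 0 < 51 * (p.c * (p.s0 * p.s0)) / 50 + p.numH ∧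
  0 < 53 * (p.c * p.s0) / 50 - p.A * p.Ap ∧ 0 < 53 * (p.c * p.s0) / 50 + p.A * p.Ap ∧
  0 < p.s0 * p.s0 / 5 - p.numR ∧ 0 < p.s0 * p.s0 / 5 + p.numR ∧
  0 < p.rhs7 e * (p.B * -p.Bm) - 2 * (p.K * p.s0 - p.P24 * (p.W0 - 1)) ∧
  0 < p.rhs8 e * (p.B * -p.Bm) - 2 * p.s0

end Pt

/-- The nine reals of the series profile at `ζ`. [folklore] -/
def pt (r c ζ : ℝ) : Pt := ⟨fW r 0 ζ, fW r 1 ζ, fW r 2 ζ, fU r 0 ζ, fU r 1 ζ, fU r 2 ζ, ζ, r, c⟩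

/-- [folklore] -/
@[simp] theorem pt_z (r c ζ : ℝ) : (pt r c ζ).z = ζ := rfl
/-- [folklore] -/
@[simp] theorem pt_r (r c ζ : ℝ) : (pt r c ζ).r = r := rfl
/-- [folklore] -/
@[simp] theorem pt_c (r c ζ : ℝ) : (pt r c ζ).c = c := rfl
/-- [folklore] -/
@[simp] theorem pt_W0 (r c ζ : ℝ) : (pt r c ζ).W0 = fW r 0 ζ := rfl
/-- [folklore] -/
@[simp] theorem pt_W1 (r c ζ : ℝ) : (pt r c ζ).W1 = fW r 1 ζ := rfl
/-- [folklore] -/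
@[simp] theorem pt_W2 (r c ζ : ℝ) : (pt r c ζ).W2 = fW r 2 ζ := rfl
/-- [folklore] -/
@[simp] theorem pt_U0 (r c ζ : ℝ) : (pt r c ζ).U0 = fU r 0 ζ := rfl
/-- [folklore] -/
@[simp] theorem pt_U1 (r c ζ : ℝ) : (pt r c ζ).U1 = fU r 1 ζ := rfl
/-- [folklore] -/
@[simp] theorem pt_U2 (r c ζ : ℝ) : (pt r c ζ).U2 = fU r 2 ζ := rfl

/-! ### Kernel side: the seventeen Taylor models -/

section Kernel

variable (D : ℕ) (h clo chi : ℚ)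

/-- `W^{(m)}`. [folklore] -/
def tW (m : ℕ) : IPoly := tmW m (D + 1) h
/-- `U_m`. [folklore] -/
def tU (m : ℕ) : IPoly := tmU m (D + 1) h
/-- `ζ`. [folklore] -/
def tZ : IPoly := tvar SB zI
/-- `1`. [folklore] -/
def tOne : IPoly := tconst (MI.ofInt SB 1)
/-- Truncated product. [folklore] -/
def pm (P Q : IPoly) : IPoly := tmulI SB h D P Q
/-- [folklore] -/
def ts0 : IPoly := tU D h 0
/-- [folklore] -/
def ts1 : IPoly := tsubI (tU D h 1) (tU D h 0)
/-- [folklore] -/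
def ts2 : IPoly := taddI (tsubI (tU D h 2) (tsmulInt 2 (tU D h 1))) (tU D h 0)
/-- [folklore] -/
def tZW1 : IPoly := pm D h (tZ) (tW D h 1)
/-- [folklore] -/
def tZW2 : IPoly := pm D h (tZ) (tW D h 2)
/-- [folklore] -/
def tWm1 : IPoly := tsubI (tW D h 0) tOne
/-- [folklore] -/
def tA : IPoly := tsubI (tsubI (tdivNat 3 (tZW1 D h)) (ts1 D h)) (tsmulInt 2 (ts0 D h))
/-- [folklore] -/
def tAp : IPoly := taddI (taddI (tdivNat 3 (tZW1 D h)) (ts1 D h)) (tsmulInt 2 (ts0 D h))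
/-- [folklore] -/
def tB : IPoly := taddI (pm D h tZ (tWm1 D h)) (ts0 D h)
/-- [folklore] -/
def tBm : IPoly := tsubI (pm D h tZ (tWm1 D h)) (ts0 D h)
/-- [folklore] -/
def tAd : IPoly := tsubI (tsubI (tdivNat 3 (tZW2 D h)) (ts2 D h)) (tsmulInt 2 (ts1 D h))
/-- [folklore] -/
def tApd : IPoly := taddI (taddI (tdivNat 3 (tZW2 D h)) (ts2 D h)) (tsmulInt 2 (ts1 D h))
/-- [folklore] -/
def tBd : IPoly := taddI (tZW1 D h) (ts1 D h)
/-- [folklore] -/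
def tBmd : IPoly := tsubI (tZW1 D h) (ts1 D h)
/-- The window of `r`. [folklore] -/
def rI : MI := ivl (13890041 / 12500000) (697 / 625)
/-- [folklore] -/
def tK : IPoly := tsubI (taddI (tdivNat 3 (tsmulInt 2 (tW D h 1))) (tsmulInt 2 (tW D h 0))) (tconst rI)
/-- [folklore] -/
def tP24 : IPoly := taddI (tsmulInt 2 (ts1 D h)) (tsmulInt 4 (ts0 D h))
/-- [folklore] -/
def tAB : IPoly := pm D h (tA D h) (tB D h)
/-- [folklore] -/
def tApBm : IPoly := pm D h (tAp D h) (tBm D h)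
/-- [folklore] -/
def tAAp : IPoly := pm D h (tA D h) (tAp D h)
/-- [folklore] -/
def ts0sq : IPoly := pm D h (ts0 D h) (ts0 D h)
/-- [folklore] -/
def tBBm : IPoly := pm D h (tB D h) (tnegI (tBm D h))
/-- [folklore] -/
def tnumG : IPoly := tsubI (pm D h (taddI (pm D h (tAd D h) (tB D h)) (pm D h (tA D h) (tBd D h))) (ts0 D h)) (pm D h (tAB D h) (ts1 D h))
/-- [folklore] -/
def tnumH : IPoly := tsubI (pm D h (taddI (pm D h (tApd D h) (tBm D h)) (pm D h (tAp D h) (tBmd D h))) (ts0 D h)) (pm D h (tApBm D h) (ts1 D h))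
/-- [folklore] -/
def tnumR : IPoly :=
  taddI (tsubI (pm D h (pm D h (tW D h 1) (tP24 D h)) (ts0 D h))
      (pm D h (taddI (tdivNat 3 (tsmulInt 2 (tW D h 2))) (tsmulInt 2 (tW D h 1))) (ts0sq D h)))
    (pm D h (tWm1 D h) (tsubI (tsmulInt 2 (pm D h (ts2 D h) (ts0 D h))) (tsmulInt 2 (pm D h (ts1 D h) (ts1 D h)))))
/-- The interval of `c`. [folklore] -/
def cI : MI := ivl clo chi
/-- The thin value `e = 1/c_hi`. [folklore] -/
def eI : MI := ofRat SB (1 / chi)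
/-- [folklore] -/
def tcs0 : IPoly := tsmulI SB (cI clo chi) (ts0 D h)
/-- [folklore] -/
def tcs0sq : IPoly := tdivNat 50 (tsmulInt 51 (tsmulI SB (cI clo chi) (ts0sq D h)))
/-- [folklore] -/
def trhs3 : IPoly := pm D h (ts0 D h) (taddI (tdivNat 50 (tsmulInt 51 (tconst (cI clo chi)))) (tdivNat 50 (tsmulInt 61 tZ)))
/-- [folklore] -/
def tcs053 : IPoly := tdivNat 50 (tsmulInt 53 (tcs0 D h clo chi))
/-- [folklore] -/
def te2Z2 : IPoly := tsmulI SB (MI.mul SB (eI chi) (eI chi)) (pm D h tZ tZ)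
/-- [folklore] -/
def te4Z4 : IPoly := pm D h (te2Z2 D h chi) (te2Z2 D h chi)
/-- [folklore] -/
def trhs7 : IPoly := tsmulI SB (eI chi) (taddI (taddI (tsmulInt 3 tOne) (tsmulInt 4 (te2Z2 D h chi))) (tsmulInt 10 (te4Z4 D h chi)))
/-- [folklore] -/
def trhs8 : IPoly := tsmulI SB (eI chi) (taddI (taddI (tdivNat 5 (tsmulInt 17 tOne)) (tsmulInt 4 (te2Z2 D h chi))) (tsmulInt 8 (te4Z4 D h chi)))

/-- [folklore] -/
def F_S : IPoly := ts0 D h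
/-- [folklore] -/
def F_Cp : IPoly := tB D h
/-- [folklore] -/
def F_Cm : IPoly := tnegI (tBm D h)
/-- [folklore] -/
def F_B1p : IPoly := tsubI (tcs0 D h clo chi) (tAB D h)
/-- [folklore] -/
def F_B1m : IPoly := taddI (tcs0 D h clo chi) (tAB D h)
/-- [folklore] -/
def F_B2p : IPoly := tsubI (tcs0sq D h clo chi) (tnumG D h)
/-- [folklore] -/
def F_B2m : IPoly := taddI (tcs0sq D h clo chi) (tnumG D h)
/-- [folklore] -/
def F_B3p : IPoly := tsubI (trhs3 D h clo chi) (tApBm D h)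
/-- [folklore] -/
def F_B3m : IPoly := taddI (trhs3 D h clo chi) (tApBm D h)
/-- [folklore] -/
def F_B4p : IPoly := tsubI (tcs0sq D h clo chi) (tnumH D h)
/-- [folklore] -/
def F_B4m : IPoly := taddI (tcs0sq D h clo chi) (tnumH D h)
/-- [folklore] -/
def F_B5p : IPoly := tsubI (tcs053 D h clo chi) (tAAp D h)
/-- [folklore] -/
def F_B5m : IPoly := taddI (tcs053 D h clo chi) (tAAp D h)
/-- [folklore] -/
def F_B6p : IPoly := tsubI (tdivNat 5 (ts0sq D h)) (tnumR D h)
/-- [folklore] -/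
def F_B6m : IPoly := taddI (tdivNat 5 (ts0sq D h)) (tnumR D h)
/-- [folklore] -/
def F_B7 : IPoly := tsubI (pm D h (trhs7 D h chi) (tBBm D h)) (tsmulInt 2 (tsubI (pm D h (tK D h) (ts0 D h)) (pm D h (tP24 D h) (tWm1 D h))))
/-- [folklore] -/
def F_B8 : IPoly := tsubI (pm D h (trhs8 D h chi) (tBBm D h)) (tsmulInt 2 (ts0 D h))

/-- THE KERNEL CHECK of one `(c, ζ)`-piece: the seventeen sign conditions on `ζ ∈ [lo, h]` for `c ∈ [clo, chi]`. [folklore] -/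
def bulkChk (lo : ℚ) (d : ℕ) : Bool :=
  posOn SB d (F_S D h) lo h && posOn SB d (F_Cp D h) lo h && posOn SB d (F_Cm D h) lo h &&
  posOn SB d (F_B1p D h clo chi) lo h && posOn SB d (F_B1m D h clo chi) lo h &&
  posOn SB d (F_B2p D h clo chi) lo h && posOn SB d (F_B2m D h clo chi) lo h &&
  posOn SB d (F_B3p D h clo chi) lo h && posOn SB d (F_B3m D h clo chi) lo h &&
  posOn SB d (F_B4p D h clo chi) lo h && posOn SB d (F_B4m D h clo chi) lo h &&
  posOn SB d (F_B5p D h clo chi) lo h && posOn SB d (F_B5m D h clo chi) lo h &&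
  posOn SB d (F_B6p D h) lo h && posOn SB d (F_B6m D h) lo h &&
  posOn SB d (F_B7 D h chi) lo h && posOn SB d (F_B8 D h chi) lo h

end Kernel

/-- [folklore] -/
theorem mem_cI {c : ℝ} {clo chi : ℚ} (hc : c ∈ Set.Icc (clo : ℝ) (chi : ℝ)) : MI.mem SB c (cI clo chi) := mem_ivl hc.1 hc.2

/-- [folklore] -/
theorem tmem_te2Z2 {D : ℕ} {h : ℚ} (h0 : 0 ≤ h) (chi : ℚ) :
    TMem SB h (fun ζ => ((1 / chi : ℚ) : ℝ) * ((1 / chi : ℚ) : ℝ) * (ζ * ζ)) (te2Z2 D h chi) := by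
  have he : MI.mem SB (((1 / chi : ℚ)) : ℝ) (eI chi) := mem_ofRat SB _
  exact tmem_congr (tmem_smulI SB_pos (MI.mem_mul SB_pos he he) (tmem_mul SB_pos h0 D (tmem_var mem_zI) (tmem_var mem_zI))) (fun ζ => by ring)

/-! ### Real side: the Taylor models enclose the seventeen polynomial functions -/

section Real

variable {r : ℝ} {D : ℕ} {h clo chi : ℚ}
  (hr : r ∈ Set.Icc ((13890041/12500000 : ℚ) : ℝ) ((697/625 : ℚ) : ℝ)) (hD : D + 1 ≤ 59) (h0 : 0 ≤ h) (hlam : lamQ * h < 1)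

include hr hD h0 hlam

/-- [folklore] -/
theorem tmem_tW {m : ℕ} (hm : m ≤ 2) : TMem SB h (fun ζ => fW r m ζ) (tW D h m) := tmem_fW hr hm hD h0 hlam

/-- [folklore] -/
theorem tmem_tU {m : ℕ} (hm : m ≤ 2) : TMem SB h (fun ζ => fU r m ζ) (tU D h m) := tmem_fU hr hm (by omega) h0 hlam

omit hr hD h0 hlam in
/-- [folklore] -/
theorem tmem_tZ : TMem SB h (fun ζ : ℝ => (0 : ℝ) + ζ) tZ := tmem_var mem_zI

omit hr hD h0 hlam in
/-- [folklore] -/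
theorem tmem_tOne : TMem SB h (fun _ : ℝ => (1 : ℝ)) tOne := by
  have h1 := MI.mem_ofInt SB 1
  push_cast at h1
  exact tmem_const h1

variable (c : ℝ)
include c

/-- [folklore] -/
theorem tmem_ts0 : TMem SB h (fun ζ => (pt r c ζ).s0) (ts0 D h) := tmem_tU hr hD h0 hlam (by norm_num)

/-- [folklore] -/
theorem tmem_ts1 : TMem SB h (fun ζ => (pt r c ζ).s1) (ts1 D h) :=
  tmem_sub (tmem_tU hr hD h0 hlam (by norm_num)) (tmem_tU hr hD h0 hlam (by norm_num))

/-- [folklore] -/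
theorem tmem_ts2 : TMem SB h (fun ζ => (pt r c ζ).s2) (ts2 D h) :=
  tmem_congr (tmem_add (tmem_sub (tmem_tU hr hD h0 hlam (by norm_num)) (tmem_smulInt 2 (tmem_tU hr hD h0 hlam (by norm_num))))
    (tmem_tU hr hD h0 hlam (by norm_num))) (fun ζ => by simp only [Pt.s2, pt_U0, pt_U1, pt_U2]; push_cast; ring)

/-- [folklore] -/
theorem tmem_tZW1 : TMem SB h (fun ζ => ζ * (pt r c ζ).W1) (tZW1 D h) :=
  tmem_congr (tmem_mul SB_pos h0 D tmem_tZ (tmem_tW hr hD h0 hlam (by norm_num))) (fun ζ => by simp only [pt_W1]; ring)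

/-- [folklore] -/
theorem tmem_tZW2 : TMem SB h (fun ζ => ζ * (pt r c ζ).W2) (tZW2 D h) :=
  tmem_congr (tmem_mul SB_pos h0 D tmem_tZ (tmem_tW hr hD h0 hlam (by norm_num))) (fun ζ => by simp only [pt_W2]; ring)

/-- [folklore] -/
theorem tmem_tWm1 : TMem SB h (fun ζ => (pt r c ζ).W0 - 1) (tWm1 D h) :=
  tmem_sub (tmem_tW hr hD h0 hlam (by norm_num)) tmem_tOne

/-- [folklore] -/
theorem tmem_tA : TMem SB h (fun ζ => (pt r c ζ).A) (tA D h) :=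
  tmem_congr (tmem_sub (tmem_sub (tmem_divNat (n := 3) (by norm_num) (tmem_tZW1 hr hD h0 hlam c)) (tmem_ts1 hr hD h0 hlam c))
    (tmem_smulInt 2 (tmem_ts0 hr hD h0 hlam c))) (fun ζ => by simp only [Pt.A, pt_z]; push_cast; ring)

/-- [folklore] -/
theorem tmem_tAp : TMem SB h (fun ζ => (pt r c ζ).Ap) (tAp D h) :=
  tmem_congr (tmem_add (tmem_add (tmem_divNat (n := 3) (by norm_num) (tmem_tZW1 hr hD h0 hlam c)) (tmem_ts1 hr hD h0 hlam c))
    (tmem_smulInt 2 (tmem_ts0 hr hD h0 hlam c))) (fun ζ => by simp only [Pt.Ap, pt_z]; push_cast; ring)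

/-- [folklore] -/
theorem tmem_tB : TMem SB h (fun ζ => (pt r c ζ).B) (tB D h) :=
  tmem_congr (tmem_add (tmem_mul SB_pos h0 D tmem_tZ (tmem_tWm1 hr hD h0 hlam c)) (tmem_ts0 hr hD h0 hlam c))
    (fun ζ => by simp only [Pt.B, pt_z]; ring)

/-- [folklore] -/
theorem tmem_tBm : TMem SB h (fun ζ => (pt r c ζ).Bm) (tBm D h) :=
  tmem_congr (tmem_sub (tmem_mul SB_pos h0 D tmem_tZ (tmem_tWm1 hr hD h0 hlam c)) (tmem_ts0 hr hD h0 hlam c))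
    (fun ζ => by simp only [Pt.Bm, pt_z]; ring)

/-- [folklore] -/
theorem tmem_tAd : TMem SB h (fun ζ => (pt r c ζ).Ad) (tAd D h) :=
  tmem_congr (tmem_sub (tmem_sub (tmem_divNat (n := 3) (by norm_num) (tmem_tZW2 hr hD h0 hlam c)) (tmem_ts2 hr hD h0 hlam c))
    (tmem_smulInt 2 (tmem_ts1 hr hD h0 hlam c))) (fun ζ => by simp only [Pt.Ad, pt_z]; push_cast; ring)

/-- [folklore] -/
theorem tmem_tApd : TMem SB h (fun ζ => (pt r c ζ).Apd) (tApd D h) :=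
  tmem_congr (tmem_add (tmem_add (tmem_divNat (n := 3) (by norm_num) (tmem_tZW2 hr hD h0 hlam c)) (tmem_ts2 hr hD h0 hlam c))
    (tmem_smulInt 2 (tmem_ts1 hr hD h0 hlam c))) (fun ζ => by simp only [Pt.Apd, pt_z]; push_cast; ring)

/-- [folklore] -/
theorem tmem_tBd : TMem SB h (fun ζ => (pt r c ζ).Bd) (tBd D h) :=
  tmem_congr (tmem_add (tmem_tZW1 hr hD h0 hlam c) (tmem_ts1 hr hD h0 hlam c)) (fun ζ => by simp only [Pt.Bd, pt_z])

/-- [folklore] -/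
theorem tmem_tBmd : TMem SB h (fun ζ => (pt r c ζ).Bmd) (tBmd D h) :=
  tmem_congr (tmem_sub (tmem_tZW1 hr hD h0 hlam c) (tmem_ts1 hr hD h0 hlam c)) (fun ζ => by simp only [Pt.Bmd, pt_z])

/-- [folklore] -/
theorem tmem_tK : TMem SB h (fun ζ => (pt r c ζ).K) (tK D h) := by
  have hrI : MI.mem SB r rI := mem_ivl hr.1 hr.2
  exact tmem_congr (tmem_sub (tmem_add (tmem_divNat (n := 3) (by norm_num) (tmem_smulInt 2 (tmem_tW hr hD h0 hlam (by norm_num))))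
    (tmem_smulInt 2 (tmem_tW hr hD h0 hlam (by norm_num)))) (tmem_const hrI)) (fun ζ => by simp only [Pt.K, pt_W0, pt_W1, pt_r]; push_cast; ring)

/-- [folklore] -/
theorem tmem_tP24 : TMem SB h (fun ζ => (pt r c ζ).P24) (tP24 D h) :=
  tmem_congr (tmem_add (tmem_smulInt 2 (tmem_ts1 hr hD h0 hlam c)) (tmem_smulInt 4 (tmem_ts0 hr hD h0 hlam c)))
    (fun ζ => by simp only [Pt.P24]; push_cast; ring)

/-- [folklore] -/
theorem tmem_tAB : TMem SB h (fun ζ => (pt r c ζ).A * (pt r c ζ).B) (tAB D h) :=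
  tmem_mul SB_pos h0 D (tmem_tA hr hD h0 hlam c) (tmem_tB hr hD h0 hlam c)

/-- [folklore] -/
theorem tmem_tApBm : TMem SB h (fun ζ => (pt r c ζ).Ap * (pt r c ζ).Bm) (tApBm D h) :=
  tmem_mul SB_pos h0 D (tmem_tAp hr hD h0 hlam c) (tmem_tBm hr hD h0 hlam c)

/-- [folklore] -/
theorem tmem_tAAp : TMem SB h (fun ζ => (pt r c ζ).A * (pt r c ζ).Ap) (tAAp D h) :=
  tmem_mul SB_pos h0 D (tmem_tA hr hD h0 hlam c) (tmem_tAp hr hD h0 hlam c)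

/-- [folklore] -/
theorem tmem_ts0sq : TMem SB h (fun ζ => (pt r c ζ).s0 * (pt r c ζ).s0) (ts0sq D h) :=
  tmem_mul SB_pos h0 D (tmem_ts0 hr hD h0 hlam c) (tmem_ts0 hr hD h0 hlam c)

/-- [folklore] -/
theorem tmem_tBBm : TMem SB h (fun ζ => (pt r c ζ).B * -(pt r c ζ).Bm) (tBBm D h) :=
  tmem_mul SB_pos h0 D (tmem_tB hr hD h0 hlam c) (tmem_neg (tmem_tBm hr hD h0 hlam c))

/-- [folklore] -/
theorem tmem_tnumG : TMem SB h (fun ζ => (pt r c ζ).numG) (tnumG D h) :=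
  tmem_congr (tmem_sub (tmem_mul SB_pos h0 D (tmem_add (tmem_mul SB_pos h0 D (tmem_tAd hr hD h0 hlam c) (tmem_tB hr hD h0 hlam c))
    (tmem_mul SB_pos h0 D (tmem_tA hr hD h0 hlam c) (tmem_tBd hr hD h0 hlam c))) (tmem_ts0 hr hD h0 hlam c))
    (tmem_mul SB_pos h0 D (tmem_tAB hr hD h0 hlam c) (tmem_ts1 hr hD h0 hlam c))) (fun ζ => by simp only [Pt.numG])

/-- [folklore] -/
theorem tmem_tnumH : TMem SB h (fun ζ => (pt r c ζ).numH) (tnumH D h) :=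
  tmem_congr (tmem_sub (tmem_mul SB_pos h0 D (tmem_add (tmem_mul SB_pos h0 D (tmem_tApd hr hD h0 hlam c) (tmem_tBm hr hD h0 hlam c))
    (tmem_mul SB_pos h0 D (tmem_tAp hr hD h0 hlam c) (tmem_tBmd hr hD h0 hlam c))) (tmem_ts0 hr hD h0 hlam c))
    (tmem_mul SB_pos h0 D (tmem_tApBm hr hD h0 hlam c) (tmem_ts1 hr hD h0 hlam c))) (fun ζ => by simp only [Pt.numH])

/-- [folklore] -/
theorem tmem_tnumR : TMem SB h (fun ζ => (pt r c ζ).numR) (tnumR D h) :=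
  tmem_congr (tmem_add (tmem_sub
      (tmem_mul SB_pos h0 D (tmem_mul SB_pos h0 D (tmem_tW hr hD h0 hlam (by norm_num)) (tmem_tP24 hr hD h0 hlam c)) (tmem_ts0 hr hD h0 hlam c))
      (tmem_mul SB_pos h0 D (tmem_add (tmem_divNat (n := 3) (by norm_num) (tmem_smulInt 2 (tmem_tW hr hD h0 hlam (by norm_num))))
        (tmem_smulInt 2 (tmem_tW hr hD h0 hlam (by norm_num)))) (tmem_ts0sq hr hD h0 hlam c)))
    (tmem_mul SB_pos h0 D (tmem_tWm1 hr hD h0 hlam c) (tmem_sub (tmem_smulInt 2 (tmem_mul SB_pos h0 D (tmem_ts2 hr hD h0 hlam c) (tmem_ts0 hr hD h0 hlam c)))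
      (tmem_smulInt 2 (tmem_mul SB_pos h0 D (tmem_ts1 hr hD h0 hlam c) (tmem_ts1 hr hD h0 hlam c))))))
    (fun ζ => by simp only [Pt.numR, pt_W0, pt_W1, pt_W2]; push_cast; ring)

variable (hc : c ∈ Set.Icc (clo : ℝ) (chi : ℝ))
include hc

/-- [folklore] -/
theorem tmem_tcs0 : TMem SB h (fun ζ => (pt r c ζ).c * (pt r c ζ).s0) (tcs0 D h clo chi) :=
  tmem_congr (tmem_smulI SB_pos (mem_cI hc) (tmem_ts0 hr hD h0 hlam c)) (fun _ => rfl)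

/-- [folklore] -/
theorem tmem_tcs0sq : TMem SB h (fun ζ => 51 * ((pt r c ζ).c * ((pt r c ζ).s0 * (pt r c ζ).s0)) / 50) (tcs0sq D h clo chi) :=
  tmem_congr (tmem_divNat (n := 50) (by norm_num) (tmem_smulInt 51 (tmem_smulI SB_pos (mem_cI hc) (tmem_ts0sq hr hD h0 hlam c))))
    (fun ζ => by simp only [pt_c]; push_cast; ring)

/-- [folklore] -/
theorem tmem_trhs3 : TMem SB h (fun ζ => (pt r c ζ).s0 * (51 * (pt r c ζ).c / 50 + 61 * (pt r c ζ).z / 50)) (trhs3 D h clo chi) :=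
  tmem_congr (tmem_mul SB_pos h0 D (tmem_ts0 hr hD h0 hlam c) (tmem_add (tmem_divNat (n := 50) (by norm_num) (tmem_smulInt 51 (tmem_const (mem_cI hc))))
    (tmem_divNat (n := 50) (by norm_num) (tmem_smulInt 61 tmem_tZ)))) (fun ζ => by simp only [pt_c, pt_z]; push_cast; ring)

/-- [folklore] -/
theorem tmem_tcs053 : TMem SB h (fun ζ => 53 * ((pt r c ζ).c * (pt r c ζ).s0) / 50) (tcs053 D h clo chi) :=
  tmem_congr (tmem_divNat (n := 50) (by norm_num) (tmem_smulInt 53 (tmem_tcs0 hr hD h0 hlam c hc))) (fun ζ => by simp only [pt_c]; push_cast; ring)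

omit hr hD hlam hc in
/-- [folklore] -/
theorem tmem_trhs7 : TMem SB h (fun ζ => (pt r c ζ).rhs7 ((1 / chi : ℚ) : ℝ)) (trhs7 D h chi) := by
  have he : MI.mem SB (((1 / chi : ℚ)) : ℝ) (eI chi) := mem_ofRat SB _
  have h2 := tmem_te2Z2 (D := D) h0 chi
  exact tmem_congr (tmem_smulI SB_pos he (tmem_add (tmem_add (tmem_smulInt 3 tmem_tOne) (tmem_smulInt 4 h2))
    (tmem_smulInt 10 (tmem_mul SB_pos h0 D h2 h2)))) (fun ζ => by simp only [Pt.rhs7, pt_z]; push_cast; ring)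

omit hr hD hlam hc in
/-- [folklore] -/
theorem tmem_trhs8 : TMem SB h (fun ζ => (pt r c ζ).rhs8 ((1 / chi : ℚ) : ℝ)) (trhs8 D h chi) := by
  have he : MI.mem SB (((1 / chi : ℚ)) : ℝ) (eI chi) := mem_ofRat SB _
  have h2 := tmem_te2Z2 (D := D) h0 chi
  exact tmem_congr (tmem_smulI SB_pos he (tmem_add (tmem_add (tmem_divNat (n := 5) (by norm_num) (tmem_smulInt 17 tmem_tOne)) (tmem_smulInt 4 h2))
    (tmem_smulInt 8 (tmem_mul SB_pos h0 D h2 h2)))) (fun ζ => by simp only [Pt.rhs8, pt_z]; push_cast; ring)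

/-- **Soundness of the kernel check of one piece**: the seventeen sign conditions hold at every `ζ ∈ [lo, h]`, for every
`r` in the window and every `c ∈ [c_lo, c_hi]`, with `e = 1/c_hi`. [cite: BuckmasterCaolaboraGomezserrano2025, Prop. 2.5, App. B] -/
theorem pos_of_bulkChk {lo : ℚ} {d : ℕ} (hchk : bulkChk D h clo chi lo d = true) (hlo : 0 ≤ lo) (hloh : lo ≤ h) {ζ : ℝ} (h1 : (lo : ℝ) ≤ ζ) (h2 : ζ ≤ h) :
    (pt r c ζ).Pos ((1 / chi : ℚ) : ℝ) := by
  have hζ : |ζ| ≤ h := by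
    have : (0 : ℝ) ≤ lo := by exact_mod_cast hlo
    rw [abs_of_nonneg (by linarith)]; exact h2
  simp only [bulkChk, Bool.and_eq_true] at hchk
  obtain ⟨⟨⟨⟨⟨⟨⟨⟨⟨⟨⟨⟨⟨⟨⟨⟨k1, k2⟩, k3⟩, k4⟩, k5⟩, k6⟩, k7⟩, k8⟩, k9⟩, k10⟩, k11⟩, k12⟩, k13⟩, k14⟩, k15⟩, k16⟩, k17⟩ := hchk
  have P := fun {f : ℝ → ℝ} {Q : IPoly} (hf : TMem SB h f Q) (hk : posOn SB d Q lo h = true) => pos_of_tmem_posOn SB_pos hf hk hloh hζ h1 h2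
  have W := fun {a b e : ℝ} (hab : a < b) (hbe : b = e) => hab.trans_eq hbe
  refine ⟨W (P (tmem_ts0 hr hD h0 hlam c) k1) rfl, W (P (tmem_tB hr hD h0 hlam c) k2) rfl, W (P (tmem_neg (tmem_tBm hr hD h0 hlam c)) k3) rfl,
    W (P (tmem_sub (tmem_tcs0 hr hD h0 hlam c hc) (tmem_tAB hr hD h0 hlam c)) k4) rfl,
    W (P (tmem_add (tmem_tcs0 hr hD h0 hlam c hc) (tmem_tAB hr hD h0 hlam c)) k5) rfl,
    W (P (tmem_sub (tmem_tcs0sq hr hD h0 hlam c hc) (tmem_tnumG hr hD h0 hlam c)) k6) rfl,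
    W (P (tmem_add (tmem_tcs0sq hr hD h0 hlam c hc) (tmem_tnumG hr hD h0 hlam c)) k7) rfl,
    W (P (tmem_sub (tmem_trhs3 hr hD h0 hlam c hc) (tmem_tApBm hr hD h0 hlam c)) k8) rfl,
    W (P (tmem_add (tmem_trhs3 hr hD h0 hlam c hc) (tmem_tApBm hr hD h0 hlam c)) k9) rfl,
    W (P (tmem_sub (tmem_tcs0sq hr hD h0 hlam c hc) (tmem_tnumH hr hD h0 hlam c)) k10) rfl,
    W (P (tmem_add (tmem_tcs0sq hr hD h0 hlam c hc) (tmem_tnumH hr hD h0 hlam c)) k11) rfl,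
    W (P (tmem_sub (tmem_tcs053 hr hD h0 hlam c hc) (tmem_tAAp hr hD h0 hlam c)) k12) rfl,
    W (P (tmem_add (tmem_tcs053 hr hD h0 hlam c hc) (tmem_tAAp hr hD h0 hlam c)) k13) rfl,
    W (P (tmem_sub (tmem_divNat (n := 5) (by norm_num) (tmem_ts0sq hr hD h0 hlam c)) (tmem_tnumR hr hD h0 hlam c)) k14) (by push_cast; ring),
    W (P (tmem_add (tmem_divNat (n := 5) (by norm_num) (tmem_ts0sq hr hD h0 hlam c)) (tmem_tnumR hr hD h0 hlam c)) k15) (by push_cast; ring),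
    W (P (tmem_sub (tmem_mul SB_pos h0 D (tmem_trhs7 h0 c) (tmem_tBBm hr hD h0 hlam c)) (tmem_smulInt 2 (tmem_sub
      (tmem_mul SB_pos h0 D (tmem_tK hr hD h0 hlam c) (tmem_ts0 hr hD h0 hlam c)) (tmem_mul SB_pos h0 D (tmem_tP24 hr hD h0 hlam c) (tmem_tWm1 hr hD h0 hlam c))))) k16)
      (by push_cast; ring),
    W (P (tmem_sub (tmem_mul SB_pos h0 D (tmem_trhs8 h0 c) (tmem_tBBm hr hD h0 hlam c)) (tmem_smulInt 2 (tmem_ts0 hr hD h0 hlam c))) k17) (by push_cast; ring)⟩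

end Real

/-- Kernel smoke test of the whole data path on a tiny model (degree 6): the sign of `ζS` on `[0, 1/10]`. [folklore] -/
theorem bulkChk_smoke : posOn SB 0 (F_S 6 (1 / 10)) 0 (1 / 10) = true := by decide +kernel

end CentreW2

end OriginSeries

end BuckmasterCaolaboraGomezserrano2025

end Literature.Analysis.FluidPDE
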